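import Literature.Topology.FourManifolds.MMSWRasmussenFacts
import Literature.Topology.FourManifolds.MMSWFibreRotation
import Literature.Topology.FourManifolds.DehnSurgery
import Literature.Topology.FourManifolds.KirbyMoves
import Literature.Topology.FourManifolds.SPC4Wave0Proofs
import Summits.SmoothPoincare4.SmoothPoincare4.Theses.DottedCircleRasmussen
import Summits.SmoothPoincare4.SmoothPoincare4.Theorems.DottedCircleRasmussenDcrGapStubFriendsH2Reduction
import Summits.SmoothPoincare4.SmoothPoincare4.Theorems.DottedCircleRasmussenDcrGapStubFriendsH2HF4

/-!
# Stub `stub_friendsH2` of line `mk_friends` for crux `DcrGap`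
(item stmt-SmoothPoincare4-16128, route route-SmoothPoincare4-DottedCircleRasmussen)

**`H₂(X; ℤ) = 0` for the friends carrier** — the `k ≥ 1` analogue of the tree's PROVED
`Knot.isZero_singularHomologyZ_two_of_isSliceDiscIn_of_range_eq` (Manolescu–Piccirillo 2023, §3.2,
proof of Lemma 3.3: for `X = X(K') ∪_Y V` glued from a trace and a slice-disc exterior "it is
routine to confirm that `X` has the homology type of `W`").  In the complement form of the
skeleton of line `mk_friends`: `X` closed smooth simply connected, `i` a germ chart of the model
dotted handlebody `D_k` on an open `U ⊇ D_k`, `f₀` a core disc for `i ∘ K₀` off `i(D_k)`, and `j` a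
smooth open embedding of the model disc exterior `E = ℝ⁴ ∖ (D_k ∪ f₁(𝔻²))` onto
`X ∖ (i(D_k) ∪ f₀(𝔻²) ∪ {q})`.

The proof is assembled from two landed pieces:

* `helper_friendsH2_of_modelHandlebody_localHomology_finite`
  (`…DcrGapStubFriendsH2Reduction`): an Euler-characteristic count with `ℚ`-coefficients — the long
  exact sequence of `(X, j(E))` with `H₃(X; ℚ) = H₁(X; ℚ) = 0` gives
  `b₂(X) = (dim H₂ E - dim H₁ E) - (dim H₃(X | C⁺) - dim H₂(X | C⁺))`, `C⁺ = i(D_k) ∪ f₀(𝔻²) ∪ {q}`,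
  and both brackets equal `dim H₃(ℝ⁴ | D_k) - 1 - dim H₂(ℝ⁴ | D_k)` by relative Mayer–Vietoris in `X`
  and in `S⁴` (where `E` is the complement of `σD_k ∪ σf₁(𝔻²) ∪ {N}`); so `b₂(X) = 0` and the free
  group `H₂(X; ℤ)` vanishes — GIVEN finite-dimensionality of `H_q(ℝ⁴ | D_k; ℚ)`, `q = 2, 3`
  (neither null-homology hypothesis is needed for the conclusion);
* `helper_modelHandlebody_localHomology_finite` (`…DcrGapStubFriendsH2HF4`): that
  finite-dimensionality, by excision into a ball, Wilder's finiteness principle (Bredon II.17) and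
  Milnor's regular-band deformation (Morse theory Thm. 3.1) along the gradient of the model level
  function (`MMSW.gradSq_pos`: no critical points on `{G_k ≥ 19/20}`).

No `sorry`, no definitions, no named facts.

## References

* C. Manolescu, L. Piccirillo, J. Lond. Math. Soc. 108 (2023), §3.2, proof of Lemma 3.3.
  [ManolescuPiccirillo2023]
* A. Hatcher, *Algebraic Topology*, CUP 2002, Thm. 2.16, §2.2 p. 152, Prop. 2B.1, Thm. 3.30.
  [HatcherAT2002]
* J. Milnor, *Morse theory*, Ann. of Math. Studies 51 (1963), Thm. 3.1. [Milnor1963]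
* G. E. Bredon, *Sheaf Theory*, 2nd ed., GTM 170, Springer 1997, §II.17. [Bredon1997]
-/

-- the prescribed namespace `Summit.<P>.<Sub>.…` duplicates `SmoothPoincare4` (P = Sub)
set_option linter.dupNamespace false
set_option linter.style.longLine false

noncomputable section

open scoped Manifold ContDiff Topology
open Function Set
open Literature.Topology.FourManifolds Literature.Topology.FourManifolds.MMSW

namespace Summit.SmoothPoincare4.SmoothPoincare4.Theorems.DcrGap.MkFriends

/-- **`H₂(X; ℤ) = 0` for the friends carrier** (stub C of line `mk_friends`; Manolescu–Piccirillo
2023, §3.2, proof of Lemma 3.3, lifted to `∂D_k = #ᵏ(S¹ × S²)`): the Euler-characteristic reduction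
`helper_friendsH2_of_modelHandlebody_localHomology_finite` applied to the finiteness theorem
`helper_modelHandlebody_localHomology_finite`. [cite: ManolescuPiccirillo2023, §3.2, proof of Lemma 3.3]
[cite: HatcherAT2002, Thm. 2.16 and Thm. 3.30] -/
theorem stub_friendsH2 : ∀ (k : ℕ) (K₀ K₁ : (Metric.sphere (0 : EuclideanSpace ℝ (Fin 2)) 1) → EuclideanSpace ℝ (Fin 4)) (f₁ : EuclideanSpace ℝ (Fin 2) → EuclideanSpace ℝ (Fin 4)), Literature.Topology.FourManifolds.MMSW.IsModelKnot k K₀ → Literature.Topology.FourManifolds.MMSW.IsNullHomologous k K₀ → Literature.Topology.FourManifolds.MMSW.IsModelKnot k K₁ → Literature.Topology.FourManifolds.MMSW.IsNullHomologous k K₁ → Literature.Topology.FourManifolds.MMSW.IsModelSliceDisc k K₁ f₁ → ∀ (X : Type) [TopologicalSpace X] [T2Space X] [SecondCountableTopology X] [ChartedSpace (EuclideanSpace ℝ (Fin 4)) X] [IsManifold (𝓡 4) ((⊤ : ℕ∞) : WithTop ℕ∞) X] [CompactSpace X] (U : Set (EuclideanSpace ℝ (Fin 4))) (i : EuclideanSpace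 ℝ (Fin 4) → X) (f₀ : EuclideanSpace ℝ (Fin 2) → X) (g₀ : EuclideanSpace ℝ (Fin 2) → EuclideanSpace ℝ (Fin 4)) (E : TopologicalSpace.Opens (EuclideanSpace ℝ (Fin 4))) (j : E → X) (q : X), (IsOpen U ∧ Literature.Topology.FourManifolds.MMSW.modelHandlebody k ⊆ U ∧ ContMDiffOn (𝓡 4) (𝓡 4) ((⊤ : ℕ∞) : WithTop ℕ∞) i U ∧ Set.InjOn i U ∧ (∀ x ∈ U, Function.Injective (mfderiv (𝓡 4) (𝓡 4) i x))) → (ContMDiff (𝓡 2) (𝓡 4) ((⊤ : ℕ∞) : WithTop ℕ∞) f₀ ∧ Set.InjOn f₀ (Metric.closedBall (0 : EuclideanSpace ℝ (Fin 2)) 1) ∧ (∀ x ∈ Metric.closedBall (0 : EuclideanSpace ℝ (Fin 2)) 1, Function.Injective (mfderiv (𝓡 2) (𝓡 4) f₀ x)) ∧ (∀ x : EuclideanSpace ℝ (Fin 2), ‖x‖ < 1 → f₀ x ∉ i '' Literature.Topology.FourManifolds.MMSW.modelHandlebody k) ∧ (∀ t : (Metric.sphere (0 : EuclideanSpace ℝ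 (Fin 2)) 1), f₀ t = i (K₀ t)) ∧ ContDiff ℝ ((⊤ : ℕ∞) : WithTop ℕ∞) g₀ ∧ (∃ η : ℝ, 0 < η ∧ (∀ x : EuclideanSpace ℝ (Fin 2), 1 - η < ‖x‖ → ‖x‖ ≤ 1 → g₀ x ∈ U ∧ f₀ x = i (g₀ x))) ∧ (∀ t : (Metric.sphere (0 : EuclideanSpace ℝ (Fin 2)) 1), deriv (fun ρ : ℝ => Literature.Topology.FourManifolds.MMSW.levelFun k (g₀ (ρ • (t : EuclideanSpace ℝ (Fin 2))))) 1 < 0)) → (((E : Set (EuclideanSpace ℝ (Fin 4))) = {x | x ∉ Literature.Topology.FourManifolds.MMSW.modelHandlebody k ∧ x ∉ f₁ '' Metric.closedBall (0 : EuclideanSpace ℝ (Fin 2)) 1}) ∧ Manifold.IsSmoothEmbedding (𝓡 4) (𝓡 4) ((⊤ : ℕ∞) : WithTop ℕ∞) j ∧ IsOpen (Set.range j) ∧ Set.range j = (i '' Literature.Topology.FourManifolds.MMSW.modelHandlebody k ∪ f₀ '' Metric.closedBall (0 : EuclideanSpace ℝ (Fin 2)) 1 ∪ {q})ᶜ ∧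 (∀ s ∈ nhds q, ∃ R : ℝ, ∀ a : E, R < ‖(a : EuclideanSpace ℝ (Fin 4))‖ → j a ∈ s)) → SimplyConnectedSpace X → CategoryTheory.Limits.IsZero (Literature.Topology.FourManifolds.singularHomologyZ X 2) :=
  helper_friendsH2_of_modelHandlebody_localHomology_finite helper_modelHandlebody_localHomology_finite

end Summit.SmoothPoincare4.SmoothPoincare4.Theorems.DcrGap.MkFriends

end
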